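import Mathlib

/-!
# B16 p. 378: «equivalent, but not equal» — the gauge-average equivalence and its transport through equivariant operations

Reproduction (statement-level, abstract, finite model) of the bookkeeping behind Balaban, *Large field renormalization. II*,
Comm. Math. Phys. 122 (1989) 355–392, p. 378 ll. 25–32 («we can remove the gauge fixing δ-functions δ_{G₀∩X_i}(V′_k) by a
reversed Faddeev–Popov procedure. This is possible only if we integrate the density with respect to the gauge field variables
V_k, at least on the components X_i. Thus, the density without the δ-functions connected with these components is equivalent,
but not equal, to the density with these functions, the equivalence understood in the same sense as for the formula (1.99)
[IV]») and p. 390–391 («it follows that the result 𝐑ρ_k of the 𝐑-operation can be written in the form (2.18) [III] … This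
completes the proof of Theorem 1»).  The 𝐑-operation therefore outputs a REPRESENTATIVE of an equivalence class (equal
integrals against gauge-invariant functions), and the induction hypothesis of [III] §2 at the next scale is verified for that
representative; the transport of the class through the later operations (the T-step of scale k+1 integrates V_k only on
Ω_{k+1} and retains it on Ω^c_{k+1}, [III] p. 256) is what makes the end statement about the actual density.  Cell GAPS G-adv3-37.

Finite model: a finite group `G` (the gauge transformations supported on a component) acts on the configurations `X` and on
the configurations `Y` of a later stage; `gaugeAvg ρ x = Σ_g ρ (g • x)`; two densities are `GaugeEquiv` when their gauge
averages agree.  Proved: (1) `GaugeEquiv` ⇒ equal weighted sums against `G`-invariant weights and observables (`sum_mul_eq_of_gaugeEquiv`);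
(2) an ADDITIVE, `G`-EQUIVARIANT operation preserves `GaugeEquiv` (`gaugeEquiv_map`), the abstract form of requirement (E1) of
G-adv3-37; (3) multiplication by an invariant function (the characteristic functions χ) is such an operation
(`gaugeEquiv_mul_invariant`).  Nothing about lattices, Haar measure or the Faddeev–Popov determinant is asserted.
[cite: Balaban1989LargeFieldII, p.378, pp.390–391; Balaban1989LargeFieldI, (1.99) p.200; Balaban1988Convergent, (2.18) p.257, p.256]
-/

namespace Literature.MathematicalPhysics.QuantumFieldTheory.Balaban1983to89.B16GaugeClassTransport

variable {G X Y : Type*} [Group G] [Fintype G] [MulAction G X] [MulAction G Y]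

/-- The gauge average `Σ_{g ∈ G} ρ (g • x)` (the reversed Faddeev–Popov insertion, up to the constant volume factor).
[cite: Balaban1989LargeFieldII, p.378] -/
noncomputable def gaugeAvg (G : Type*) [Group G] [Fintype G] [MulAction G X] (ρ : X → ℝ) (x : X) : ℝ :=
  ∑ g : G, ρ (g • x)

/-- «equivalent, but not equal»: equal gauge averages. [cite: Balaban1989LargeFieldII, p.378] -/
def GaugeEquiv (G : Type*) [Group G] [Fintype G] [MulAction G X] (ρ₁ ρ₂ : X → ℝ) : Prop :=
  gaugeAvg G ρ₁ = gaugeAvg G ρ₂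

/-- `G`-invariance of a function on `X`. [folklore] -/
def Invariant (G : Type*) [Group G] [MulAction G X] (F : X → ℝ) : Prop := ∀ g : G, ∀ x, F (g • x) = F x

/-- Weighted sum against an invariant weight `w` and an invariant observable `F`: `|G| · Σ_x w x ρ x F x = Σ_x w x (avg ρ) x F x`.
[cite: Balaban1989LargeFieldI, (1.99) p.200] -/
theorem card_smul_sum_eq_sum_gaugeAvg [Fintype X] (w F ρ : X → ℝ) (hw : Invariant G w) (hF : Invariant G F) :
    (Fintype.card G : ℝ) * ∑ x, w x * ρ x * F x = ∑ x, w x * gaugeAvg G ρ x * F x := by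
  unfold gaugeAvg
  have hre : ∀ g : G, ∑ x, w x * ρ (g • x) * F x = ∑ x, w x * ρ x * F x := by
    intro g
    calc ∑ x, w x * ρ (g • x) * F x = ∑ x, w (g • x) * ρ (g • x) * F (g • x) := by
          refine Finset.sum_congr rfl fun x _ => ?_
          rw [hw g x, hF g x]
      _ = ∑ x, w x * ρ x * F x := by
          exact Equiv.sum_comp (MulAction.toPerm g) (fun x => w x * ρ x * F x)
  calc (Fintype.card G : ℝ) * ∑ x, w x * ρ x * F x = ∑ _g : G, ∑ x, w x * ρ x * F x := by
        rw [Finset.sum_const, Finset.card_univ, nsmul_eq_mul]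
    _ = ∑ g : G, ∑ x, w x * ρ (g • x) * F x := by
        refine Finset.sum_congr rfl fun g _ => ?_
        rw [hre g]
    _ = ∑ x, w x * (∑ g : G, ρ (g • x)) * F x := by
        rw [Finset.sum_comm]
        refine Finset.sum_congr rfl fun x _ => ?_
        rw [Finset.mul_sum, Finset.sum_mul]

/-- Equivalent densities have equal weighted sums against invariant weights and observables — the content of «equivalent»
on p. 378 / (1.99) [IV]. [cite: Balaban1989LargeFieldII, p.378] -/
theorem sum_mul_eq_of_gaugeEquiv [Fintype X] (w F ρ₁ ρ₂ : X → ℝ) (hw : Invariant G w) (hF : Invariant G F)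
    (h : GaugeEquiv G ρ₁ ρ₂) :
    ∑ x, w x * ρ₁ x * F x = ∑ x, w x * ρ₂ x * F x := by
  have hc : (Fintype.card G : ℝ) ≠ 0 := by exact_mod_cast Fintype.card_ne_zero
  apply mul_left_cancel₀ hc
  rw [card_smul_sum_eq_sum_gaugeAvg w F ρ₁ hw hF, card_smul_sum_eq_sum_gaugeAvg w F ρ₂ hw hF]
  unfold GaugeEquiv at h
  rw [h]

/-- An operation `Op` (density at one stage ↦ density at the next) is `G`-equivariant when transforming the input by `g`
transforms the output by `g` (the induced action on the later-stage variables). [folklore] -/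
def Equivariant (G : Type*) [Group G] [MulAction G X] [MulAction G Y] (Op : (X → ℝ) → (Y → ℝ)) : Prop :=
  ∀ (g : G) (ρ : X → ℝ), Op (fun x => ρ (g • x)) = fun y => Op ρ (g • y)

/-- An additive equivariant operation commutes with the gauge average. [folklore] -/
theorem gaugeAvg_map (Op : (X → ℝ) →+ (Y → ℝ)) (hOp : Equivariant G Op) (ρ : X → ℝ) :
    gaugeAvg G (Op ρ) = Op (gaugeAvg G ρ) := by
  funext y
  unfold gaugeAvg
  have : (fun x => ∑ g : G, ρ (g • x)) = ∑ g : G, (fun x => ρ (g • x)) := by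
    funext x; simp [Finset.sum_apply]
  rw [this, map_sum, Finset.sum_apply]
  refine Finset.sum_congr rfl fun g _ => ?_
  rw [hOp g ρ]

/-- (E1) of G-adv3-37, abstractly: an additive `G`-equivariant operation maps equivalent densities to equivalent densities
— the property every later T-step, characteristic function and 𝐑-step must have for the representative produced on p. 378
to stand for the actual density. [cite: Balaban1989LargeFieldII, p.378, pp.390–391] -/
theorem gaugeEquiv_map (Op : (X → ℝ) →+ (Y → ℝ)) (hOp : Equivariant G Op) {ρ₁ ρ₂ : X → ℝ}
    (h : GaugeEquiv G ρ₁ ρ₂) : GaugeEquiv G (Op ρ₁) (Op ρ₂) := by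
  unfold GaugeEquiv at *
  rw [gaugeAvg_map Op hOp, gaugeAvg_map Op hOp, h]

/-- Multiplication by a `G`-invariant function (a characteristic function χ of plaquette variables) as an additive map. [folklore] -/
def mulBy (χ : X → ℝ) : (X → ℝ) →+ (X → ℝ) where
  toFun ρ := fun x => χ x * ρ x
  map_zero' := by funext x; simp
  map_add' ρ₁ ρ₂ := by funext x; simp [mul_add]

omit [Fintype G] in
/-- Multiplication by an invariant function is equivariant. [folklore] -/
theorem mulBy_equivariant (χ : X → ℝ) (hχ : Invariant G χ) : Equivariant G (mulBy χ) := by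
  intro g ρ
  funext x
  simp [mulBy, hχ g x]

/-- Multiplying equivalent densities by the same invariant characteristic function keeps them equivalent. [folklore] -/
theorem gaugeEquiv_mul_invariant (χ : X → ℝ) (hχ : Invariant G χ) {ρ₁ ρ₂ : X → ℝ} (h : GaugeEquiv G ρ₁ ρ₂) :
    GaugeEquiv G (fun x => χ x * ρ₁ x) (fun x => χ x * ρ₂ x) :=
  gaugeEquiv_map (mulBy χ) (mulBy_equivariant χ hχ) h

omit [Fintype G] in
/-- Composition of equivariant additive operations is equivariant (the chain of steps k+1, …, K). [folklore] -/
theorem equivariant_comp {Z : Type*} [MulAction G Z] (Op₁ : (X → ℝ) →+ (Y → ℝ)) (Op₂ : (Y → ℝ) →+ (Z → ℝ))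
    (h₁ : Equivariant G Op₁) (h₂ : Equivariant G Op₂) : Equivariant G (Op₂.comp Op₁) := by
  intro g ρ
  simp only [AddMonoidHom.comp_apply]
  rw [h₁ g ρ, h₂ g (Op₁ ρ)]

end Literature.MathematicalPhysics.QuantumFieldTheory.Balaban1983to89.B16GaugeClassTransport
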